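import Literature.Analysis.FunctionSpaces.BesselK
import Mathlib.Analysis.SpecialFunctions.Gaussian.GaussianIntegral
import Mathlib.MeasureTheory.Integral.IntegralEqImproper
import Mathlib.Analysis.SpecialFunctions.Trigonometric.DerivHyp
import HarnessLib

/-!
# The Macdonald function of order one half: `K_{1/2}(x) = √(π/(2x)) e^{−x}`

Topic `Analysis/FunctionSpaces` (namespace `Literature.Analysis.FunctionSpaces`), continuing
`BesselK.lean` (`besselK ν z = ∫₀^∞ e^{−z cosh t} cosh(νt) dt`, Bateman–Grosswald's (2)). Everything
here is PROVED (theorems only).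

The classical closed form (Watson, *A Treatise on the Theory of Bessel Functions*, §3.71 (13);
DLMF 10.39.2): for `x > 0`,

* `besselK_half_ofReal`: `K_{1/2}(x) = √(π/(2x)) e^{−x}`,

by `cosh t = 1 + 2 sinh²(t/2)` and the substitution `u = sinh(t/2)`, `du = ½ cosh(t/2) dt`, which
turns `∫₀^∞ e^{−x cosh t} cosh(t/2) dt` into `2 e^{−x} ∫₀^∞ e^{−2x u²} du = e^{−x} √(π/(2x))`
(Mathlib `integral_comp_mul_deriv_Ioi`, `integral_gaussian_Ioi`). This is the kernel of the
`s = 1` case of the Fourier–Bessel expansion of a lattice line (`r^{½} K_{1/2}(2πrY) = e^{−2πrY}/(2√Y)`),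
used for the exponentially small terms `A_r` of Baker's limit formula (*Transcendental Number
Theory*, Ch. 5 §3: "It is easily confirmed that `I_r(1) = π e^{−π|r|√d/(ka)}`").

## References

* G. N. Watson, *A Treatise on the Theory of Bessel Functions*, 2nd ed. (1944), §3.71 (13), §6.22.
* [Baker1975] A. Baker, *Transcendental Number Theory* (1975), Ch. 5 §3.
-/

noncomputable section

open MeasureTheory Set Real Filter Topology

namespace Literature.Analysis.FunctionSpaces

/-- `cosh t = 1 + 2 sinh²(t/2)`. [folklore] -/
theorem cosh_eq_one_add_two_mul_sinh_half_sq (t : ℝ) :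
    Real.cosh t = 1 + 2 * Real.sinh (t / 2) ^ 2 := by
  have h := Real.cosh_two_mul (t / 2)
  rw [show 2 * (t / 2) = t by ring] at h
  rw [h]
  nlinarith [Real.cosh_sq (t / 2)]

/-- `sinh(t/2) → ∞`. [folklore] -/
theorem tendsto_sinh_half_atTop : Tendsto (fun t : ℝ => Real.sinh (t / 2)) atTop atTop := by
  have h1 : Tendsto (fun t : ℝ => t / 2) atTop atTop := tendsto_id.atTop_div_const (by norm_num)
  refine tendsto_atTop_mono' atTop ?_ h1
  filter_upwards [eventually_ge_atTop (0 : ℝ)] with t ht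
  exact Real.self_le_sinh_iff.mpr (by linarith)

/-- The real integrand of `K_{1/2}(x)` is integrable on `(0, ∞)` for `x > 0`. [folklore] -/
theorem integrableOn_exp_neg_mul_cosh_mul_cosh {x : ℝ} (hx : 0 < x) (ν : ℝ) :
    IntegrableOn (fun t : ℝ => Real.exp (-x * Real.cosh t) * Real.cosh (ν * t)) (Ioi 0) := by
  have h := (integrable_besselKIntegrand (ν := (ν : ℂ)) (z := (x : ℂ)) (by simpa using hx)).norm
  refine (h.congr ?_).integrableOn
  exact Eventually.of_forall fun t => by
    simp only []
    rw [besselKIntegrand_ofReal, Complex.norm_real, Real.norm_eq_abs,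
      abs_of_nonneg (besselKIntegrand_re_nonneg ν x t)]

/-- **The substitution `u = sinh(t/2)`**:
`∫₀^∞ e^{−x cosh t} cosh(t/2) dt = ∫₀^∞ 2 e^{−x} e^{−2x u²} du` (`x > 0`). [folklore] -/
theorem integral_exp_neg_mul_cosh_mul_cosh_half {x : ℝ} (hx : 0 < x) :
    ∫ t in Ioi (0 : ℝ), Real.exp (-x * Real.cosh t) * Real.cosh (1 / 2 * t) =
      ∫ u in Ioi (0 : ℝ), 2 * Real.exp (-x) * Real.exp (-(2 * x) * u ^ 2) := by
  set f : ℝ → ℝ := fun t => Real.sinh (t / 2) with hf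
  set f' : ℝ → ℝ := fun t => Real.cosh (t / 2) / 2 with hf'
  set g : ℝ → ℝ := fun u => 2 * Real.exp (-x) * Real.exp (-(2 * x) * u ^ 2) with hg
  have hderiv : ∀ t : ℝ, HasDerivAt f (f' t) t := by
    intro t
    have h1 : HasDerivAt (fun t : ℝ => t / 2) (1 / 2) t := by
      simpa using (hasDerivAt_id t).div_const 2
    have h2 : HasDerivAt (fun t : ℝ => Real.sinh (t / 2)) (Real.cosh (t / 2) * (1 / 2)) t :=
      HasDerivAt.sinh h1
    simp only [hf, hf']
    rw [show Real.cosh (t / 2) / 2 = Real.cosh (t / 2) * (1 / 2) by ring]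
    exact h2
  have hcomp : ∀ t : ℝ, (g ∘ f) t * f' t = Real.exp (-x * Real.cosh t) * Real.cosh (1 / 2 * t) := by
    intro t
    simp only [Function.comp_apply, hf, hf', hg]
    rw [cosh_eq_one_add_two_mul_sinh_half_sq t, show (1 : ℝ) / 2 * t = t / 2 by ring,
      show -x * (1 + 2 * Real.sinh (t / 2) ^ 2) = -x + -(2 * x) * Real.sinh (t / 2) ^ 2 by ring,
      Real.exp_add]
    ring
  have hf0 : f 0 = 0 := by simp [hf]
  have hgc : Continuous g := by simp only [hg]; fun_prop
  have hgi : Integrable g :=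
    (integrable_exp_neg_mul_sq (by linarith : (0 : ℝ) < 2 * x)).const_mul (2 * Real.exp (-x))
  have hint : IntegrableOn (fun t => (g ∘ f) t * f' t) (Ici 0) := by
    rw [integrableOn_Ici_iff_integrableOn_Ioi]
    exact (integrableOn_exp_neg_mul_cosh_mul_cosh hx (1 / 2)).congr_fun (fun t _ => (hcomp t).symm)
      measurableSet_Ioi
  have key := integral_comp_mul_deriv_Ioi (f := f) (f' := f') (g := g) (a := 0)
    (Real.continuous_sinh.comp (continuous_id.div_const 2)).continuousOn tendsto_sinh_half_atTop
    (fun t _ => (hderiv t).hasDerivWithinAt) hgc.continuousOn hgi.integrableOn hint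
  rw [hf0] at key
  rw [← key]
  exact setIntegral_congr_fun measurableSet_Ioi fun t _ => (hcomp t).symm

/-- **`K_{1/2}(x) = √(π/(2x)) e^{−x}`** for `x > 0` (Watson §3.71 (13); DLMF 10.39.2).
[cite: Baker1975, Ch. 5 §3] -/
theorem besselK_half_ofReal {x : ℝ} (hx : 0 < x) :
    besselK (1 / 2 : ℂ) (x : ℂ) = ((Real.sqrt (π / (2 * x)) * Real.exp (-x) : ℝ) : ℂ) := by
  have h := besselK_ofReal (1 / 2) x
  push_cast at h
  rw [h, integral_exp_neg_mul_cosh_mul_cosh_half hx, integral_const_mul, integral_gaussian_Ioi (2 * x)]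
  push_cast
  ring

end Literature.Analysis.FunctionSpaces
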